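import Literature.NumberTheory.GaloisRepresentations.SemiLocalUnitGroupShapiro
import Mathlib.RepresentationTheory.Coinduced
import HarnessLib

/-!
# Equivariant homomorphisms into the semi-local module: `Hom_G(X, ∏_{w∣v} E_wˣ) = Hom_{G_w}(X, E_wˣ)`
# (Frobenius reciprocity for `∏_{w∣v} E_wˣ ≅ Coind_{G_w}^G E_wˣ`; Harari §13.1, Brown III (5.8)–(5.9))

Topic `NumberTheory/GaloisRepresentations`; namespace `Literature.NumberTheory.GaloisRepresentations.SemiLocal`.
Definitions with bodies and theorems; NO named fact, no `sorry`, no instance, no notation; number fields in `Type`.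
Sequel to `SemiLocalShapiro.lean` (`unitsRep F E v = ∏_{w∣v} E_wˣ`, `localUnitsRep w = E_wˣ` as a `G_w`-module,
**`unitsRepIsoCoind w : unitsRep F E v ≅ Coind_{G_w}^G (localUnitsRep w)`**, `unitsProj w`) and
`SemiLocalUnitGroupShapiro.lean` (`unitGroupRep F E v = ∏_{w∣v} 𝒪_wˣ`, `unitGroupRepHom`, `placeUnitGroup w`).

Why (Route A of crux `AnticycControlAdditiveK`, item 19295; door-c6 g16's presentation road, hypothesis (R3) of
`middleExact_allPlaces_of_readout`, FINDING-door-c6-g16 §3 F6 / §5: "`Hom_G(N₁, J_E) = ∏'_v Hom_{D_w}(N₁, E_wˣ)`").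
The idèle-valued equivariant homomorphism `f : N₁ → J_E` of Milne's Lemma I 4.13 is ASSEMBLED place by place from
LOCAL equivariant homomorphisms.  At one finite place `v` of the base field this is Frobenius reciprocity for the
co-induced module `∏_{w∣v} E_wˣ ≅ Coind_{G_w}^G E_wˣ` (Harari §13.1 "`I_K(v) = I_G^{G_v}(K_v^*)`"; Brown III (5.9):
`Hom_G(M, Coind_H^G N) ≅ Hom_H(Res M, N)`): a `G_w`-equivariant `φ : X → E_wˣ` extends UNIQUELY to a `G`-equivariant
`Φ : X → ∏_{w'∣v} E_{w'}ˣ` with `w`-component `φ` — explicitly `Φ(x)_{g w} = g_w(φ(g⁻¹ x))` — and `Φ` takes values in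
the local units `∏ 𝒪_{w'}ˣ` as soon as `φ` takes values in `𝒪_wˣ` (the `g_w` are isometries).  Mathlib supplies the
adjunction `Rep.resCoindHomEquiv`; this file composes it with the tree's `unitsRepIsoCoind` and reads off the
components.

## What is formalised (`F E : Type` number fields, `[IsGalois F E]`, `G = E ≃ₐ[F] E`, `w : Place F E v`, `X : Rep ℤ G`)

* **`assemble w φ : X ⟶ unitsRep F E v`** for `φ : Res_{G_w} X ⟶ localUnitsRep w`; **`unitsProj_assemble`**
  (`(Φ x)_w = φ x`), **`unitsProj_ρ_assemble`** (`(g • Φ x)_w = φ (g • x)`), `toMul_unitsProj_smul_assemble` /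
  `valued_assemble_smul` (`(Φ x)_{g w} = g_w(φ(g⁻¹ x))`, so `v_{g w}((Φ x)_{g w}) = v_w(φ(g⁻¹ x))`).
* uniqueness / the bijection: `localComponent w Φ : Res_{G_w} X ⟶ localUnitsRep w` (the `w`-component of a
  `G`-morphism as a `G_w`-morphism), `assemble_localComponent`, `localComponent_assemble`,
  **`hom_ext_of_unitsProj_eq`**, **`eq_assemble_of_unitsProj_eq`** (a `G`-morphism into `∏ E_wˣ` is determined by
  its `w`-component).
* units: **`liftUnitGroup Φ h : X ⟶ unitGroupRep F E v`** (`Φ` with values in `∏ 𝒪_wˣ`), `liftUnitGroup_comp`,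
  **`toMul_assemble_mem_unitGroup`** (`φ` valued in `𝒪_wˣ` ⟹ `assemble w φ` valued in `∏ 𝒪_{w'}ˣ`),
  **`assembleUnit w φ hφ : X ⟶ unitGroupRep F E v`**, `assembleUnit_comp_unitGroupRepHom`.

## References
* D. Harari, *Galois Cohomology and Class Field Theory* (2020), §13.1 (`I_K(v) = I_G^{G_v}(K_v^*)`). [Harari2020]
* K. S. Brown, *Cohomology of Groups*, GTM 87 (1982), III §5 (5.8)–(5.9), §6 (6.2) (Frobenius reciprocity /
  Shapiro). [Brown1982CohomologyGroups]
* J. S. Milne, *Arithmetic Duality Theorems* (2nd ed. 2006), I Lemma 4.13 (proof). [MilneADT2006]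
* J. W. S. Cassels, A. Fröhlich (eds.), *Algebraic Number Theory* (1967), Ch. VII (Tate) §1.1. [CasselsFrohlichANT1967]
-/

noncomputable section

open NumberField IsDedekindDomain CategoryTheory
open Literature.NumberTheory.Automorphic

namespace Literature.NumberTheory.GaloisRepresentations

namespace SemiLocal

variable {F : Type} [Field F] [NumberField F] {E : Type} [Field E] [NumberField E] [Algebra F E]
variable {v : HeightOneSpectrum (𝓞 F)} [IsGalois F E]
variable {X : Rep.{0} ℤ (E ≃ₐ[F] E)}

/-! ## §1. Assembling a `G`-morphism `X → ∏_{w∣v} E_wˣ` from a `G_w`-morphism `X → E_wˣ` -/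

/-- **The `G`-equivariant extension `Φ : X → ∏_{w'∣v} E_{w'}ˣ` of a `G_w`-equivariant `φ : X → E_wˣ`**
(Frobenius reciprocity `Hom_{G_w}(Res X, E_wˣ) ≅ Hom_G(X, Coind E_wˣ)` composed with `∏ E_wˣ ≅ Coind_{G_w}^G E_wˣ`;
explicitly `Φ(x)_{g w} = g_w(φ(g⁻¹ x))`). [cite: Harari2020, §13.1] [cite: Brown1982CohomologyGroups, III §5 (5.9)] -/
def assemble (w : Place F E v)
    (φ : Rep.res (MulAction.stabilizer (E ≃ₐ[F] E) w).subtype X ⟶ localUnitsRep w) : X ⟶ unitsRep F E v :=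
  (Rep.resCoindHomEquiv.{0, 0, 0, 0} (MulAction.stabilizer (E ≃ₐ[F] E) w).subtype X (localUnitsRep w) φ) ≫
    (unitsRepIsoCoind w).inv

/-- `assemble φ` followed by `∏ E_wˣ ≅ Coind` is the adjunct of `φ`. [cite: Brown1982CohomologyGroups, III §5 (5.9)] -/
theorem assemble_comp_unitsRepIsoCoind_hom (w : Place F E v)
    (φ : Rep.res (MulAction.stabilizer (E ≃ₐ[F] E) w).subtype X ⟶ localUnitsRep w) :
    assemble w φ ≫ (unitsRepIsoCoind w).hom =
      Rep.resCoindHomEquiv.{0, 0, 0, 0} (MulAction.stabilizer (E ≃ₐ[F] E) w).subtype X (localUnitsRep w) φ := by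
  rw [assemble, Category.assoc, Iso.inv_hom_id, Category.comp_id]

/-- **The `w`-component of `g • Φ(x)` is `φ(g • x)`** (`Φ = assemble w φ`; the adjunct evaluated at `g`).
[cite: Brown1982CohomologyGroups, III §5 (5.9)] -/
theorem unitsProj_ρ_assemble (w : Place F E v)
    (φ : Rep.res (MulAction.stabilizer (E ≃ₐ[F] E) w).subtype X ⟶ localUnitsRep w) (g : E ≃ₐ[F] E) (x : X.V) :
    unitsProj w ((unitsRep F E v).ρ g ((assemble w φ).hom x)) = φ.hom (X.ρ g x) := by
  have h := congrArg (fun ψ : X ⟶ Rep.coind (MulAction.stabilizer (E ≃ₐ[F] E) w).subtype (localUnitsRep w) =>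
    (ψ.hom x).1 g) (assemble_comp_unitsRepIsoCoind_hom w φ)
  dsimp only at h
  rw [Rep.comp_apply, unitsRepIsoCoind_hom_apply, ← unitsRep_ρ_apply, Rep.resCoindHomEquiv_apply,
    Rep.resCoindToHom_hom_apply_coe] at h
  exact h

/-- **The `w`-component of `Φ(x)` is `φ(x)`.** [cite: Brown1982CohomologyGroups, III §5 (5.9)] -/
theorem unitsProj_assemble (w : Place F E v)
    (φ : Rep.res (MulAction.stabilizer (E ≃ₐ[F] E) w).subtype X ⟶ localUnitsRep w) (x : X.V) :
    unitsProj w ((assemble w φ).hom x) = φ.hom x := by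
  letI : Module ℤ X.V := X.hV2
  have h := unitsProj_ρ_assemble w φ 1 x
  rwa [map_one, map_one, Module.End.one_apply, Module.End.one_apply] at h

/-- **The `w'`-component of `Φ(x)` at `w' = g w`, read in `E_{w'}`: `(Φ x)_{g w} = g_w(φ(g⁻¹ x))`.**
[cite: Harari2020, §13.1] [cite: CasselsFrohlichANT1967, Ch. VII §1.1] -/
theorem toMul_unitsProj_smul_assemble (w : Place F E v)
    (φ : Rep.res (MulAction.stabilizer (E ≃ₐ[F] E) w).subtype X ⟶ localUnitsRep w) (g : E ≃ₐ[F] E) (x : X.V) :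
    ((Additive.toMul (unitsProj (g • w) ((assemble w φ).hom x)) :
        (((g • w : Place F E v) : HeightOneSpectrum (𝓞 E)).adicCompletion E)ˣ) :
          ((g • w : Place F E v) : HeightOneSpectrum (𝓞 E)).adicCompletion E) =
      galAdicCompletionMap g (Place.smul_coe g w)
        ((Additive.toMul (α := ((w : HeightOneSpectrum (𝓞 E)).adicCompletion E)ˣ) (φ.hom (X.ρ g⁻¹ x)) :
            ((w : HeightOneSpectrum (𝓞 E)).adicCompletion E)ˣ) : (w : HeightOneSpectrum (𝓞 E)).adicCompletion E) := by
  -- `Φ x = g • Φ(g⁻¹ x)` and `(g • u)_{g w} = g_w(u_w)`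
  letI : Module ℤ X.V := X.hV2
  have hx : (assemble w φ).hom x = (unitsRep F E v).ρ g ((assemble w φ).hom (X.ρ g⁻¹ x)) := by
    rw [← Rep.hom_comm_apply, ← Module.End.mul_apply, ← map_mul, mul_inv_cancel, map_one, Module.End.one_apply]
  rw [hx, val_toMul_unitsProj, unitsRep_ρ_apply, toMul_ofMul, val_smul_units, smul_apply_smul,
    ← val_toMul_unitsProj, unitsProj_assemble]

/-- **Valuations of the components**: `v_{g w}((Φ x)_{g w}) = v_w(φ(g⁻¹ x))` (the `g_w` are isometries).
[cite: CasselsFrohlichANT1967, Ch. VII §1.1] -/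
theorem valued_assemble_smul (w : Place F E v)
    (φ : Rep.res (MulAction.stabilizer (E ≃ₐ[F] E) w).subtype X ⟶ localUnitsRep w) (g : E ≃ₐ[F] E) (x : X.V) :
    Valued.v (((Additive.toMul (unitsProj (g • w) ((assemble w φ).hom x)) :
        (((g • w : Place F E v) : HeightOneSpectrum (𝓞 E)).adicCompletion E)ˣ) :
          ((g • w : Place F E v) : HeightOneSpectrum (𝓞 E)).adicCompletion E)) =
      Valued.v ((Additive.toMul (α := ((w : HeightOneSpectrum (𝓞 E)).adicCompletion E)ˣ) (φ.hom (X.ρ g⁻¹ x)) :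
            ((w : HeightOneSpectrum (𝓞 E)).adicCompletion E)ˣ) : (w : HeightOneSpectrum (𝓞 E)).adicCompletion E) := by
  rw [toMul_unitsProj_smul_assemble, valued_galAdicCompletionMap]

/-! ## §2. Uniqueness: a `G`-morphism into `∏_{w∣v} E_wˣ` is determined by its `w`-component -/

/-- **The `w`-component of a `G`-morphism `Φ : X → ∏ E_wˣ` as a `G_w`-morphism `Res X → E_wˣ`** (the inverse
adjunct). [cite: Brown1982CohomologyGroups, III §5 (5.9)] -/
def localComponent (w : Place F E v) (Φ : X ⟶ unitsRep F E v) :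
    Rep.res (MulAction.stabilizer (E ≃ₐ[F] E) w).subtype X ⟶ localUnitsRep w :=
  (Rep.resCoindHomEquiv.{0, 0, 0, 0} (MulAction.stabilizer (E ≃ₐ[F] E) w).subtype X (localUnitsRep w)).symm
    (Φ ≫ (unitsRepIsoCoind w).hom)

/-- `localComponent w Φ x = (Φ x)_w`. [cite: Brown1982CohomologyGroups, III §5 (5.9)] -/
theorem localComponent_apply (w : Place F E v) (Φ : X ⟶ unitsRep F E v) (x : X.V) :
    (localComponent w Φ).hom x = unitsProj w (Φ.hom x) := by
  change ((Φ ≫ (unitsRepIsoCoind w).hom).hom x).1 1 = _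
  rw [Rep.comp_apply, unitsRepIsoCoind_hom_apply, one_smul, ofMul_toMul]

/-- **`assemble (localComponent Φ) = Φ`**: a `G`-morphism into `∏_{w∣v} E_wˣ` is recovered from its `w`-component.
[cite: Brown1982CohomologyGroups, III §5 (5.9)] -/
theorem assemble_localComponent (w : Place F E v) (Φ : X ⟶ unitsRep F E v) :
    assemble w (localComponent w Φ) = Φ := by
  rw [assemble, localComponent, LinearEquiv.apply_symm_apply, Category.assoc, Iso.hom_inv_id, Category.comp_id]

/-- `localComponent (assemble φ) = φ`. [cite: Brown1982CohomologyGroups, III §5 (5.9)] -/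
theorem localComponent_assemble (w : Place F E v)
    (φ : Rep.res (MulAction.stabilizer (E ≃ₐ[F] E) w).subtype X ⟶ localUnitsRep w) :
    localComponent w (assemble w φ) = φ := by
  rw [localComponent, assemble_comp_unitsRepIsoCoind_hom, LinearEquiv.symm_apply_apply]

/-- **Uniqueness**: two `G`-morphisms `X → ∏_{w∣v} E_wˣ` with the same `w`-components are equal.
[cite: Brown1982CohomologyGroups, III §5 (5.9)] -/
theorem hom_ext_of_unitsProj_eq (w : Place F E v) {Φ Ψ : X ⟶ unitsRep F E v}
    (h : ∀ x : X.V, unitsProj w (Φ.hom x) = unitsProj w (Ψ.hom x)) : Φ = Ψ := by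
  have hc : localComponent w Φ = localComponent w Ψ := by
    letI : Module ℤ X.V := X.hV2
    refine Rep.hom_ext (Representation.IntertwiningMap.ext (LinearMap.ext fun x => ?_))
    change (localComponent w Φ).hom x = (localComponent w Ψ).hom x
    rw [localComponent_apply, localComponent_apply, h]
  rw [← assemble_localComponent w Φ, hc, assemble_localComponent]

/-- A `G`-morphism whose `w`-component is `φ` is `assemble w φ`. [cite: Brown1982CohomologyGroups, III §5 (5.9)] -/
theorem eq_assemble_of_unitsProj_eq (w : Place F E v)
    (φ : Rep.res (MulAction.stabilizer (E ≃ₐ[F] E) w).subtype X ⟶ localUnitsRep w) {Ψ : X ⟶ unitsRep F E v}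
    (h : ∀ x : X.V, unitsProj w (Ψ.hom x) = φ.hom x) : Ψ = assemble w φ :=
  hom_ext_of_unitsProj_eq w fun x => by rw [h, unitsProj_assemble]

/-! ## §3. Values in the local units `∏_{w∣v} 𝒪_wˣ` -/

omit [IsGalois F E] in
/-- A `G`-morphism into `∏ E_wˣ` with values in `∏ 𝒪_wˣ`, corestricted, as an additive map (auxiliary for
`liftUnitGroup`). [cite: Harari2020, §13.1 (the `G`-module `U_K(v)`)] -/
def liftUnitGroupAddHom (Φ : X ⟶ unitsRep F E v)
    (h : ∀ x : X.V, Additive.toMul (α := (SemiLocal F E v)ˣ) (Φ.hom x) ∈ unitGroup F E v) :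
    X.V →+ Additive (unitGroup F E v) where
  toFun x := Additive.ofMul ⟨Additive.toMul (α := (SemiLocal F E v)ˣ) (Φ.hom x), h x⟩
  map_zero' := Additive.toMul.injective (Subtype.ext (by
    change Additive.toMul (α := (SemiLocal F E v)ˣ) (Φ.hom 0) = 1
    rw [map_zero]
    rfl))
  map_add' x y := Additive.toMul.injective (Subtype.ext (by
    change Additive.toMul (α := (SemiLocal F E v)ˣ) (Φ.hom (x + y)) =
      Additive.toMul (α := (SemiLocal F E v)ˣ) (Φ.hom x) * Additive.toMul (α := (SemiLocal F E v)ˣ) (Φ.hom y)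
    rw [map_add]
    rfl))

omit [IsGalois F E] in
/-- **A `G`-morphism into `∏ E_wˣ` with values in `∏ 𝒪_wˣ` factors through `unitGroupRep`.**
[cite: Harari2020, §13.1 (the `G`-module `U_K(v)`)] -/
def liftUnitGroup (Φ : X ⟶ unitsRep F E v)
    (h : ∀ x : X.V, Additive.toMul (α := (SemiLocal F E v)ˣ) (Φ.hom x) ∈ unitGroup F E v) :
    X ⟶ unitGroupRep F E v :=
  letI : Module ℤ X.V := X.hV2
  Rep.ofHom (ρ := X.ρ)
    ⟨{ toFun := liftUnitGroupAddHom Φ h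
       map_add' := fun x y => map_add (liftUnitGroupAddHom Φ h) x y
       map_smul' := fun c x => by
         simpa only [Int.cast_id, RingHom.id_apply] using map_intCast_smul (liftUnitGroupAddHom Φ h) ℤ ℤ c x },
      fun g => LinearMap.ext fun x => Additive.toMul.injective (Subtype.ext (by
        change Additive.toMul (α := (SemiLocal F E v)ˣ) (Φ.hom (X.ρ g x)) =
          g • Additive.toMul (α := (SemiLocal F E v)ˣ) (Φ.hom x)
        rw [Rep.hom_comm_apply, unitsRep_ρ_apply, toMul_ofMul]))⟩

omit [IsGalois F E] in
/-- Unfolding `liftUnitGroup`: the underlying unit of `∏ E_w` is that of `Φ`. [cite: Harari2020, §13.1] -/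
theorem coe_toMul_liftUnitGroup (Φ : X ⟶ unitsRep F E v)
    (h : ∀ x : X.V, Additive.toMul (α := (SemiLocal F E v)ˣ) (Φ.hom x) ∈ unitGroup F E v) (x : X.V) :
    ((Additive.toMul (α := unitGroup F E v) ((liftUnitGroup Φ h).hom x) : unitGroup F E v) : (SemiLocal F E v)ˣ) =
      Additive.toMul (α := (SemiLocal F E v)ˣ) (Φ.hom x) :=
  rfl

omit [IsGalois F E] in
/-- `liftUnitGroup Φ h ≫ (∏ 𝒪_wˣ ↪ ∏ E_wˣ) = Φ`. [cite: Harari2020, §13.1] -/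
theorem liftUnitGroup_comp (Φ : X ⟶ unitsRep F E v)
    (h : ∀ x : X.V, Additive.toMul (α := (SemiLocal F E v)ˣ) (Φ.hom x) ∈ unitGroup F E v) :
    liftUnitGroup Φ h ≫ unitGroupRepHom F E v = Φ := by
  letI : Module ℤ X.V := X.hV2
  exact Rep.hom_ext (Representation.IntertwiningMap.ext (LinearMap.ext fun _ => rfl))

/-- **If `φ` takes values in `𝒪_wˣ`, then `assemble w φ` takes values in `∏_{w'∣v} 𝒪_{w'}ˣ`** (every `w' = g w`,
and `v_{g w}((Φ x)_{g w}) = v_w(φ(g⁻¹ x)) = 1`). [cite: CasselsFrohlichANT1967, Ch. VII §1.1] [cite: Harari2020, §13.1] -/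
theorem toMul_assemble_mem_unitGroup (w : Place F E v)
    (φ : Rep.res (MulAction.stabilizer (E ≃ₐ[F] E) w).subtype X ⟶ localUnitsRep w)
    (hφ : ∀ x : X.V, Additive.toMul (α := ((w : HeightOneSpectrum (𝓞 E)).adicCompletion E)ˣ) (φ.hom x) ∈
      placeUnitGroup w) (x : X.V) :
    Additive.toMul (α := (SemiLocal F E v)ˣ) ((assemble w φ).hom x) ∈ unitGroup F E v := by
  refine mem_unitGroup_iff.mpr fun w' => ?_
  obtain ⟨g, rfl⟩ := Place.exists_smul_eq w w'
  rw [← val_toMul_unitsProj, valued_assemble_smul]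
  exact (mem_placeUnitGroup_iff w _).mp (hφ _)

/-- **The `G`-morphism `X → ∏_{w∣v} 𝒪_wˣ` assembled from a `G_w`-morphism `X → 𝒪_wˣ ⊆ E_wˣ`.**
[cite: Harari2020, §13.1 (the `G`-module `U_K(v)`)] -/
def assembleUnit (w : Place F E v)
    (φ : Rep.res (MulAction.stabilizer (E ≃ₐ[F] E) w).subtype X ⟶ localUnitsRep w)
    (hφ : ∀ x : X.V, Additive.toMul (α := ((w : HeightOneSpectrum (𝓞 E)).adicCompletion E)ˣ) (φ.hom x) ∈
      placeUnitGroup w) : X ⟶ unitGroupRep F E v :=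
  liftUnitGroup (assemble w φ) (toMul_assemble_mem_unitGroup w φ hφ)

/-- `assembleUnit ≫ (∏ 𝒪_wˣ ↪ ∏ E_wˣ) = assemble`. [cite: Harari2020, §13.1] -/
theorem assembleUnit_comp_unitGroupRepHom (w : Place F E v)
    (φ : Rep.res (MulAction.stabilizer (E ≃ₐ[F] E) w).subtype X ⟶ localUnitsRep w)
    (hφ : ∀ x : X.V, Additive.toMul (α := ((w : HeightOneSpectrum (𝓞 E)).adicCompletion E)ˣ) (φ.hom x) ∈
      placeUnitGroup w) :
    assembleUnit w φ hφ ≫ unitGroupRepHom F E v = assemble w φ :=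
  liftUnitGroup_comp _ _

/-- Components of `assembleUnit`: the underlying unit of `∏ E_w` is that of `assemble w φ`. [cite: Harari2020, §13.1] -/
theorem coe_toMul_assembleUnit (w : Place F E v)
    (φ : Rep.res (MulAction.stabilizer (E ≃ₐ[F] E) w).subtype X ⟶ localUnitsRep w)
    (hφ : ∀ x : X.V, Additive.toMul (α := ((w : HeightOneSpectrum (𝓞 E)).adicCompletion E)ˣ) (φ.hom x) ∈
      placeUnitGroup w) (x : X.V) :
    ((Additive.toMul (α := unitGroup F E v) ((assembleUnit w φ hφ).hom x) : unitGroup F E v) :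
        (SemiLocal F E v)ˣ) = Additive.toMul (α := (SemiLocal F E v)ˣ) ((assemble w φ).hom x) :=
  rfl

end SemiLocal

end Literature.NumberTheory.GaloisRepresentations

end
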